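import Mathlib
import HarnessLib.Audit
import Summits.PneNP.PneNP.Theorems.PstarChordReadSwitch
import Summits.PneNP.PneNP.Theorems.PstarChordReadsGates

/-!
# Switch gates on chord privates: move formulas, double-slice points, simple gates (ROUND-24, O1 at exact tightness; memo §6.10 bookkeeping)

FRONTIER range-avoidance ladder, rung F-N3, ROUND 24 (cell `pnp-ideate`, prover-2 memo `g19/O1-CHORD-READ.md` §6.4–§6.10; referee SCORE 223 Finding A
(non-parallel chords) and C (fibre bookkeeping); typed target `PstarCoreBoundTargets.TerminalPeelable` (p646951); restricted-model proof complexity —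
nothing here bears on `P` versus `NP`).

The SYNTACTIC layer under `PstarChordReadSwitch` (whose kills take semantic switch hypotheses):

* `sliceGeneric_mono` — slice genericity for a menu gives it for every sub-menu;
* `coef_switch` / `gval_flip_switch` — a SWITCH `z` (an outside variable whose only monomial, if any, is one gate `g` with AND pair `{v, z}`) moves the
  reader `(C, G)` by `[z ∈ C] ⊕ ([g ∈ G] ∧ x_v)` (from `PstarChordReadsGates.gval_update_not_coef`);
* `exists_two_slices` — DOUBLE-SLICE POINTS: for two distinct NON-PARALLEL chords `cᵢ, cⱼ` with `cᵢ` slice-generic, every prescription of the four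
  privates is realised by a solution of the core (slice genericity applied to the pair read `{aⱼ, bⱼ}`; this is where Finding A's non-parallelism is
  consumed — parallel chords have empty double slices for half the fibres);
* `SimpleGate I J₀ w₁ w₂ c g v z` — `g` is a SIMPLE SWITCH GATE on the chord `c`: AND pair `{v, z}` with `v` a private of `c`, `z` outside the core,
  `z` in no other monomial, and no other monomial touches the AND pair of `c` (the cheapest gated reading of a chord at exact tightness, memo §6.4);
  with its unpacking lemmas (`SimpleGate.flip₁/flip₂`, `SimpleGate.mono_of_not_mem`, …) feeding the type kills.

No Assumption A.  The capstone (two simple-gated slice-generic chords ⟹ dead, all types) is `PstarChordReadTwoGates`.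
-/

set_option linter.dupNamespace false -- `Summit.PneNP.PneNP.…`: summit = sub-problem name (D-0017 single-conjunct layout)

open Finset Literature.Computability.Complexity
open Summit.PneNP.PneNP.Theorems.PstarFibrePolys (bit bit_injective bit_xor bit_and)
open Summit.PneNP.PneNP.Theorems.PstarSALevel (varSet bdry)
open Summit.PneNP.PneNP.Theorems.PstarGapPeeling (eval_update_of_not_mem not_mem_varSet_of_private)
open Summit.PneNP.PneNP.Theorems.PstarCentreFree (vars_mem_varSet)
open Summit.PneNP.PneNP.Theorems.PstarGapOneAll (gval)
open Summit.PneNP.PneNP.Theorems.PstarGConstraint (gval_false)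
open Summit.PneNP.PneNP.Theorems.PstarChordRepair (IsChord)
open Summit.PneNP.PneNP.Theorems.PstarChordBridgeTools (coef)
open Summit.PneNP.PneNP.Theorems.PstarChordReadsGates (gval_update_not_coef)
open Summit.PneNP.PneNP.Theorems.PstarFreshErase (bit_eval_e slots_ne)
open Summit.PneNP.PneNP.Theorems.PstarChordReads (eval_update_of_private)
open Summit.PneNP.PneNP.Theorems.PstarChordReadsMirror (gval_pair solves_set_privates)
open Summit.PneNP.PneNP.Theorems.PstarChordReadLemma (ChordLocal SliceGeneric)

namespace Summit.PneNP.PneNP.Theorems.PstarChordReadGates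

variable {n m : ℕ}

/-! ## Menus -/

/-- **Slice genericity is inherited by sub-menus.** -/
theorem sliceGeneric_mono {I : LocalMap 4 n m} {y : Fin m → Bool} {J₀ : Finset (Fin m)} {c : Fin m} {𝒢 𝒢' : Finset (Fin m)} (h : 𝒢' ⊆ 𝒢)
    (hgen : SliceGeneric I y J₀ c 𝒢) : SliceGeneric I y J₀ c 𝒢' :=
  fun C G t b hp hq hG hfail => hgen C G t b hp hq (hG.trans h) hfail

/-! ## Switches -/
section Switch

variable (I : LocalMap 4 n m) {C : Finset (Fin n)} {G : Finset (Fin m)} {g : Fin m} {v z : Fin n}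

/-- **The read coefficient of a switch.**  If the only monomial of `G` that may contain `z` is `g`, with AND pair `{v, z}`, then
`coef z = [z ∈ C] + [g ∈ G]·x_v`. -/
theorem coef_switch (hvz : v ≠ z) (hg : (I.vars g 2 = v ∧ I.vars g 3 = z) ∨ (I.vars g 2 = z ∧ I.vars g 3 = v))
    (hother : ∀ g' ∈ G, g' ≠ g → I.vars g' 2 ≠ z ∧ I.vars g' 3 ≠ z) (X : Fin n → ZMod 2) :
    coef I C G z X = (if z ∈ C then 1 else 0) + (if g ∈ G then X v else 0) := by
  classical
  unfold coef
  congr 1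
  have hzero : ∀ g' ∈ G, g' ≠ g →
      ((if I.vars g' 2 = z then X (I.vars g' 3) else 0) + (if I.vars g' 3 = z then X (I.vars g' 2) else 0)) = 0 := by
    intro g' hg' hne
    rw [if_neg (hother g' hg' hne).1, if_neg (hother g' hg' hne).2, add_zero]
  by_cases hgG : g ∈ G
  · rw [if_pos hgG, ← add_sum_erase G _ hgG, sum_eq_zero (fun g' hg' => hzero g' (mem_of_mem_erase hg') (ne_of_mem_erase hg')), add_zero]
    rcases hg with ⟨h2, h3⟩ | ⟨h2, h3⟩
    · rw [h2, h3, if_neg hvz, if_pos rfl, zero_add]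
    · rw [h2, h3, if_pos rfl, if_neg hvz, add_zero]
  · rw [if_neg hgG]
    exact sum_eq_zero fun g' hg' => hzero g' hg' (fun h => hgG (h ▸ hg'))

/-- **Flipping a switch**: `gval (x with z flipped) = gval x ⊕ [z ∈ C] ⊕ ([g ∈ G] ∧ x_v)`. -/
theorem gval_flip_switch (hI : I.IsPure xorAndPred) (hvz : v ≠ z) (hg : (I.vars g 2 = v ∧ I.vars g 3 = z) ∨ (I.vars g 2 = z ∧ I.vars g 3 = v))
    (hother : ∀ g' ∈ G, g' ≠ g → I.vars g' 2 ≠ z ∧ I.vars g' 3 ≠ z) (x : Fin n → Bool) :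
    gval I C G (Function.update x z (!x z)) = xor (gval I C G x) (xor (decide (z ∈ C)) (decide (g ∈ G) && x v)) := by
  classical
  rw [gval_update_not_coef I hI C G x z, coef_switch I hvz hg hother]
  by_cases hC : z ∈ C <;> by_cases hG : g ∈ G <;> simp only [hC, hG, if_true, if_false, decide_true, decide_false] <;>
    cases x v <;> cases gval I C G x <;> simp [bit]

end Switch

/-! ## Double-slice points -/
section TwoSlices

variable {I : LocalMap 4 n m} {y : Fin m → Bool} {J₀ : Finset (Fin m)} {cᵢ cⱼ : Fin m} {𝒢 : Finset (Fin m)}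

/-- A variable outside `varSet c` is none of the four variables of `c`. -/
private theorem ne_vars_of_not_mem {u : Fin n} {c : Fin m} (h : u ∉ varSet I c) (s : Fin 4) : u ≠ I.vars c s :=
  fun e => h (e ▸ vars_mem_varSet I c s)

/-- Non-parallelism is symmetric: if an XOR variable of `cᵢ` is not a variable of `cⱼ`, then an XOR variable of `cⱼ` is outside `{aᵢ, bᵢ}`. -/
theorem exists_xor_not_mem (hI : I.IsPure xorAndPred) (hv : ∃ s : Fin 4, s.val < 2 ∧ I.vars cᵢ s ∉ varSet I cⱼ) :
    ∃ s : Fin 4, s.val < 2 ∧ I.vars cⱼ s ≠ I.vars cᵢ 0 ∧ I.vars cⱼ s ≠ I.vars cᵢ 1 := by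
  obtain ⟨s, hs, hvs⟩ := hv
  have hs01 : s = 0 ∨ s = 1 := by
    rcases Nat.lt_or_ge s.val 1 with h | h
    · exact Or.inl (Fin.ext (show s.val = 0 by omega))
    · exact Or.inr (Fin.ext (show s.val = 1 by omega))
  have hj01 : I.vars cⱼ 0 ≠ I.vars cⱼ 1 := fun h => absurd (hI.2 cⱼ h) (by decide)
  by_contra h
  push Not at h
  have h0 := h 0 (by decide)
  have h1 := h 1 (by decide)
  -- both XOR variables of `cⱼ` lie in `{aᵢ, bᵢ}`; being distinct they ARE `{aᵢ, bᵢ}`, so `vars cᵢ s ∈ varSet cⱼ`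
  have m0 : I.vars cⱼ 0 = I.vars cᵢ 0 ∨ I.vars cⱼ 0 = I.vars cᵢ 1 := by
    by_cases e : I.vars cⱼ 0 = I.vars cᵢ 0
    · exact Or.inl e
    · exact Or.inr (h0 e)
  have m1 : I.vars cⱼ 1 = I.vars cᵢ 0 ∨ I.vars cⱼ 1 = I.vars cᵢ 1 := by
    by_cases e : I.vars cⱼ 1 = I.vars cᵢ 0
    · exact Or.inl e
    · exact Or.inr (h1 e)
  have key : I.vars cᵢ s = I.vars cⱼ 0 ∨ I.vars cᵢ s = I.vars cⱼ 1 := by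
    rcases m0 with e0 | e0 <;> rcases m1 with e1 | e1
    · exact absurd (e0.trans e1.symm) hj01
    · rcases hs01 with rfl | rfl
      · exact Or.inl e0.symm
      · exact Or.inr e1.symm
    · rcases hs01 with rfl | rfl
      · exact Or.inr e1.symm
      · exact Or.inl e0.symm
    · exact absurd (e0.trans e1.symm) hj01
  rcases key with e | e
  · exact hvs (e ▸ vars_mem_varSet I cⱼ 0)
  · exact hvs (e ▸ vars_mem_varSet I cⱼ 1)

/-- **DOUBLE-SLICE POINTS.**  For two distinct non-parallel chords `cᵢ, cⱼ` with `cᵢ` slice-generic (any menu), every prescription of the four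
privates `(pᵢ, qᵢ, pⱼ, qⱼ)` is realised by a solution of the core: slice genericity of `cᵢ` applied to the pair read `{aⱼ, bⱼ}` gives a solution of
`J₀ ∖ cᵢ` with both `x_{aᵢ} ⊕ x_{bᵢ}` and `x_{aⱼ} ⊕ x_{bⱼ}` prescribed (else `x_{aⱼ} ⊕ x_{bⱼ}` would be a function of `x_{aᵢ} ⊕ x_{bᵢ}` — false for
non-parallel chords), and the privates are then set freely. -/
theorem exists_two_slices (hI : I.IsPure xorAndPred) (hcᵢ : cᵢ ∈ J₀) (hcⱼ : cⱼ ∈ J₀) (hne : cᵢ ≠ cⱼ) (hchᵢ : IsChord I J₀ cᵢ)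
    (hchⱼ : IsChord I J₀ cⱼ) (hv : ∃ s : Fin 4, s.val < 2 ∧ I.vars cᵢ s ∉ varSet I cⱼ) (hgen : SliceGeneric I y J₀ cᵢ 𝒢)
    (πᵢ κᵢ πⱼ κⱼ : Bool) :
    ∃ x : Fin n → Bool, (∀ j ∈ J₀, I.eval x j = y j) ∧ x (I.vars cᵢ 2) = πᵢ ∧ x (I.vars cᵢ 3) = κᵢ ∧
      x (I.vars cⱼ 2) = πⱼ ∧ x (I.vars cⱼ 3) = κⱼ := by
  classical
  -- distinctness bookkeeping
  have hpᵢ : I.vars cᵢ 2 ∉ varSet I cⱼ := not_mem_varSet_of_private I hcᵢ hcⱼ hne.symm hchᵢ.1 (vars_mem_varSet I cᵢ 2)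
  have hqᵢ : I.vars cᵢ 3 ∉ varSet I cⱼ := not_mem_varSet_of_private I hcᵢ hcⱼ hne.symm hchᵢ.2 (vars_mem_varSet I cᵢ 3)
  have hpⱼ : I.vars cⱼ 2 ∉ varSet I cᵢ := not_mem_varSet_of_private I hcⱼ hcᵢ hne hchⱼ.1 (vars_mem_varSet I cⱼ 2)
  have hqⱼ : I.vars cⱼ 3 ∉ varSet I cᵢ := not_mem_varSet_of_private I hcⱼ hcᵢ hne hchⱼ.2 (vars_mem_varSet I cⱼ 3)
  have hj01 : I.vars cⱼ 0 ≠ I.vars cⱼ 1 := fun h => absurd (hI.2 cⱼ h) (by decide)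
  have hj23 : I.vars cⱼ 2 ≠ I.vars cⱼ 3 := fun h => absurd (hI.2 cⱼ h) (by decide)
  have hi23 : I.vars cᵢ 2 ≠ I.vars cᵢ 3 := fun h => absurd (hI.2 cᵢ h) (by decide)
  have hppⱼ : (I.vars cⱼ 2 = I.vars cⱼ 2 ∧ I.vars cⱼ 3 = I.vars cⱼ 3) ∨ (I.vars cⱼ 2 = I.vars cⱼ 3 ∧ I.vars cⱼ 3 = I.vars cⱼ 2) :=
    Or.inl ⟨rfl, rfl⟩
  obtain ⟨-, hj0p, hj0q, hj1p, hj1q⟩ := slots_ne hI hppⱼ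
  -- a solution of `J₀ ∖ cᵢ` on the slice `tᵢ` with the pair read of `cⱼ` equal to `tⱼ`
  obtain ⟨x, hx, hxi, hxj⟩ : ∃ x : Fin n → Bool, (∀ j ∈ J₀.erase cᵢ, I.eval x j = y j) ∧
      xor (x (I.vars cᵢ 0)) (x (I.vars cᵢ 1)) = xor (y cᵢ) (πᵢ && κᵢ) ∧
      xor (x (I.vars cⱼ 0)) (x (I.vars cⱼ 1)) = xor (y cⱼ) (πⱼ && κⱼ) := by
    by_contra hno
    push Not at hno
    have hsub : ({I.vars cⱼ 0, I.vars cⱼ 1} : Finset (Fin n)) ⊆ varSet I cⱼ := by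
      intro u hu
      rcases mem_insert.1 hu with e | e
      · exact e ▸ vars_mem_varSet I cⱼ 0
      · exact (mem_singleton.1 e) ▸ vars_mem_varSet I cⱼ 1
    obtain ⟨φ, hφ⟩ := hgen {I.vars cⱼ 0, I.vars cⱼ 1} ∅ (xor (y cᵢ) (πᵢ && κᵢ)) (xor (y cⱼ) (πⱼ && κⱼ))
      (fun h => hpᵢ (hsub h)) (fun h => hqᵢ (hsub h)) (empty_subset _)
      (fun x hx hxi h => hno x hx hxi (by rw [← h, gval_pair I hj01]))
    obtain ⟨s, hs, hs0, hs1⟩ := exists_xor_not_mem hI hv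
    have h0 := hφ (fun _ => false)
    have h1 := hφ (Function.update (fun _ => false) (I.vars cⱼ s) true)
    rw [gval_pair I hj01] at h0 h1
    rw [Function.update_of_ne hs0.symm, Function.update_of_ne hs1.symm] at h1
    have hs01 : s = 0 ∨ s = 1 := by
      rcases Nat.lt_or_ge s.val 1 with h | h
      · exact Or.inl (Fin.ext (show s.val = 0 by omega))
      · exact Or.inr (Fin.ext (show s.val = 1 by omega))
    rcases hs01 with rfl | rfl
    · rw [Function.update_self, Function.update_of_ne hj01.symm] at h1
      rw [← h0] at h1
      exact absurd h1 (by decide)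
    · rw [Function.update_self, Function.update_of_ne hj01] at h1
      rw [← h0] at h1
      exact absurd h1 (by decide)
  -- set the privates of `cⱼ`
  set x' := Function.update (Function.update x (I.vars cⱼ 2) πⱼ) (I.vars cⱼ 3) κⱼ with hx'def
  have hx' : ∀ j ∈ J₀.erase cᵢ, I.eval x' j = y j := by
    rw [hx'def]
    intro j hj
    have hjJ : j ∈ J₀ := mem_of_mem_erase hj
    by_cases hjc : j = cⱼ
    · subst hjc
      apply bit_injective
      rw [bit_eval_e hI hppⱼ, Function.update_self, Function.update_of_ne hj23, Function.update_self, Function.update_of_ne hj0q,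
        Function.update_of_ne hj0p, Function.update_of_ne hj1q, Function.update_of_ne hj1p]
      have e : ∀ A B P K Y : Bool, xor A B = xor Y (P && K) → bit A + bit B + bit P * bit K = bit Y := by decide
      exact e _ _ _ _ _ hxj
    · rw [eval_update_of_private hcⱼ hjJ hjc hchⱼ.2 (vars_mem_varSet I cⱼ 3) _ κⱼ,
        eval_update_of_private hcⱼ hjJ hjc hchⱼ.1 (vars_mem_varSet I cⱼ 2) x πⱼ]
      exact hx j hj
  have hxi' : xor (xor (x' (I.vars cᵢ 0)) (x' (I.vars cᵢ 1))) (πᵢ && κᵢ) = y cᵢ := by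
    rw [hx'def, Function.update_of_ne (ne_vars_of_not_mem hqⱼ 0).symm, Function.update_of_ne (ne_vars_of_not_mem hpⱼ 0).symm,
      Function.update_of_ne (ne_vars_of_not_mem hqⱼ 1).symm, Function.update_of_ne (ne_vars_of_not_mem hpⱼ 1).symm, hxi]
    cases y cᵢ <;> cases (πᵢ && κᵢ) <;> rfl
  -- set the privates of `cᵢ`
  refine ⟨_, solves_set_privates hI hcᵢ hchᵢ hx' πᵢ κᵢ hxi', ?_, ?_, ?_, ?_⟩
  · rw [Function.update_of_ne hi23, Function.update_self]
  · rw [Function.update_self]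
  · rw [Function.update_of_ne (ne_vars_of_not_mem hpⱼ 3), Function.update_of_ne (ne_vars_of_not_mem hpⱼ 2), hx'def,
      Function.update_of_ne hj23, Function.update_self]
  · rw [Function.update_of_ne (ne_vars_of_not_mem hqⱼ 3), Function.update_of_ne (ne_vars_of_not_mem hqⱼ 2), hx'def, Function.update_self]

end TwoSlices

/-! ## Simple switch gates -/
section Simple

variable {I : LocalMap 4 n m} {J₀ : Finset (Fin m)} {w₁ w₂ : Finset (Fin n) × Finset (Fin m) × Bool} {c g : Fin m} {v z : Fin n}

/-- `g` is a **SIMPLE SWITCH GATE** on the chord `c` (for the readers `w₁, w₂`): a monomial output of `w₁` or `w₂` with AND pair `{v, z}`, `v` a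
private AND variable of `c`, `z` OUTSIDE the core, `z` in no other monomial of `w₁, w₂`, and no other monomial of `w₁, w₂` touching the AND pair
of `c`.  (`z` may occur in the linear parts — that is the switch's type `e`.) -/
def SimpleGate (I : LocalMap 4 n m) (J₀ : Finset (Fin m)) (w₁ w₂ : Finset (Fin n) × Finset (Fin m) × Bool) (c g : Fin m) (v z : Fin n) :
    Prop :=
  g ∈ w₁.2.1 ∪ w₂.2.1 ∧ (v = I.vars c 2 ∨ v = I.vars c 3) ∧ ((I.vars g 2 = v ∧ I.vars g 3 = z) ∨ (I.vars g 2 = z ∧ I.vars g 3 = v)) ∧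
    (∀ j ∈ J₀, z ∉ varSet I j) ∧ (∀ g' ∈ w₁.2.1 ∪ w₂.2.1, g' ≠ g → I.vars g' 2 ≠ z ∧ I.vars g' 3 ≠ z) ∧
    (∀ g' ∈ w₁.2.1 ∪ w₂.2.1, g' ≠ g → (I.vars g' 2 ≠ I.vars c 2 ∧ I.vars g' 3 ≠ I.vars c 2) ∧ (I.vars g' 2 ≠ I.vars c 3 ∧ I.vars g' 3 ≠ I.vars c 3))

/-- The private `v` is a variable of `c`, hence `v ≠ z`. -/
theorem SimpleGate.ne (h : SimpleGate I J₀ w₁ w₂ c g v z) (hc : c ∈ J₀) : v ≠ z := by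
  rcases h.2.1 with e | e <;> exact fun hvz => h.2.2.2.1 c hc (hvz ▸ e ▸ vars_mem_varSet I c _)

/-- **Move of `Γ₁` under the switch**: `[z ∈ C₁] ⊕ ([g ∈ G₁] ∧ x_v)`. -/
theorem SimpleGate.flip₁ (h : SimpleGate I J₀ w₁ w₂ c g v z) (hI : I.IsPure xorAndPred) (hc : c ∈ J₀) (x : Fin n → Bool) :
    gval I w₁.1 w₁.2.1 (Function.update x z (!x z)) = xor (gval I w₁.1 w₁.2.1 x) (xor (decide (z ∈ w₁.1)) (decide (g ∈ w₁.2.1) && x v)) :=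
  gval_flip_switch I hI (h.ne hc) h.2.2.1 (fun g' hg' hne => h.2.2.2.2.1 g' (mem_union_left _ hg') hne) x

/-- **Move of `Γ₂` under the switch**: `[z ∈ C₂] ⊕ ([g ∈ G₂] ∧ x_v)`. -/
theorem SimpleGate.flip₂ (h : SimpleGate I J₀ w₁ w₂ c g v z) (hI : I.IsPure xorAndPred) (hc : c ∈ J₀) (x : Fin n → Bool) :
    gval I w₂.1 w₂.2.1 (Function.update x z (!x z)) = xor (gval I w₂.1 w₂.2.1 x) (xor (decide (z ∈ w₂.1)) (decide (g ∈ w₂.2.1) && x v)) :=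
  gval_flip_switch I hI (h.ne hc) h.2.2.1 (fun g' hg' hne => h.2.2.2.2.1 g' (mem_union_right _ hg') hne) x

/-- If `g` is not a monomial of the reader `(C, G)` (`G ⊆ G₁ ∪ G₂`), that reader's monomials avoid the AND pair of `c`. -/
theorem SimpleGate.mono_of_not_mem (h : SimpleGate I J₀ w₁ w₂ c g v z) {G : Finset (Fin m)} (hG : G ⊆ w₁.2.1 ∪ w₂.2.1) (hg : g ∉ G) :
    ∀ g' ∈ G, (I.vars g' 2 ≠ I.vars c 2 ∧ I.vars g' 3 ≠ I.vars c 2) ∧ (I.vars g' 2 ≠ I.vars c 3 ∧ I.vars g' 3 ≠ I.vars c 3) :=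
  fun g' hg' => h.2.2.2.2.2 g' (hG hg') (fun e => hg (e ▸ hg'))

/-- If `g` is not a monomial of the reader `(C, G)`, that reader's monomials avoid `z`. -/
theorem SimpleGate.invisible_of_not_mem (h : SimpleGate I J₀ w₁ w₂ c g v z) {G : Finset (Fin m)} (hG : G ⊆ w₁.2.1 ∪ w₂.2.1) (hg : g ∉ G) :
    ∀ g' ∈ G, I.vars g' 2 ≠ z ∧ I.vars g' 3 ≠ z :=
  fun g' hg' => h.2.2.2.2.1 g' (hG hg') (fun e => hg (e ▸ hg'))

/-- The switch variable is not a variable of any other chord's slice bookkeeping: `z ≠ vars c' s` for `c' ∈ J₀`. -/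
theorem SimpleGate.ne_vars (h : SimpleGate I J₀ w₁ w₂ c g v z) {c' : Fin m} (hc' : c' ∈ J₀) (s : Fin 4) : z ≠ I.vars c' s :=
  fun e => h.2.2.2.1 c' hc' (e ▸ vars_mem_varSet I c' s)

end Simple

end Summit.PneNP.PneNP.Theorems.PstarChordReadGates
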